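import Summits.CriticalPhenomena.PercolationContinuityZ3.Theorems.PercNearOneGluingNoHeavyRsw3InvasionTreeCutEdges
import Summits.CriticalPhenomena.PercolationContinuityZ3.Theorems.PercNearOneGluingNoHeavyRsw3InvasionZeroDensity
import Summits.CriticalPhenomena.PercolationContinuityZ3.Theorems.PercNearOneGluingNoHeavyRsw3InvasionPonds
import Summits.CriticalPhenomena.PercolationContinuityZ3.Theorems.PercNearOneGluingNoHeavyRsw3InvasionMaxLabel
import Literature.Probability.Percolation.CriticalContinuityProofs
import HarnessLib

/-!
# RSW3 lane (P2, gen 29): INVASION PERCOLATION XXX — **THE INVASION TREE OF `ℤ^d` HAS ONE END, IN EVERY DIMENSION `d ≥ 2`**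
# (Lyons–Peres–Schramm 2006, Thm. 3.12 / Alexander 1995, whose hypothesis `θ(p_c) = 0` is p205010), AND THE POND–OUTLET CHAIN OF
# Damron–Sapozhnikov–Vágvölgyi EXISTS: a.s. infinitely many outlets, labels `τ̂_1 > τ̂_2 > ⋯ ↓ p_c(ℤ^d)`, each a cut-edge separating the origin from `∞`

builds on p205010 (kernel theorem, internal audit signed; external expert review pending) — USED (through gen 26 file V,
`ae_frequently_criticalProb_lt_acceptedLabel`, i.e. `CSH.percolationContinuity_allDimensions`) in every unconditional `ℤ^d` statement of §2–§6; the structural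
theorem `ae_forall_exists_isOutlet_of_continuity` takes `θ(p_c(ℤ^d)) = 0` as a hypothesis.  Status sentence: "θ(p_c) = 0 on ℤ^d, all d ≥ 2 —
kernel-verified (Lean 4/Mathlib, standard axioms); internal adversarial audit SIGNED 2026-08-20 04:29Z; external expert review pending."

Cell `prim-rsw3`, prover seat `prim-rsw3-p2` (gen 29), memo `run/shared/lean/prim/rsw3/P2-RSWLITE.md` §36.  Support file
(`--supports stmt-CriticalPhenomena-4575`); no definitions, no named facts, no sorries.  `μ = labelMeasure (Site d)`, `x_n(U) = acceptedLabel (zdGraph d) U 0 n`,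
`I_n = invasion (zdGraph d) U 0 n`, `T = Invasion.tree (zdGraph d) U 0`, `IsOutlet … m :⟺ ∀ n > m, x_n < x_m`.

Lyons–Peres–Schramm 2006, proof of Thm. 3.12: "Suppose that `θ(p_c) = 0`.  Then `sup_{n ≥ k} U(e_n) > p_c` for any `k`.  By Lemma 3.11,
`limsup U(e_n) = p_c`.  For each `k` such that `U(e_k) = sup_{n ≥ k} U(e_n)`, the edge `e_k` separates `o` from `∞` in the invasion tree of `o`.  It
follows that the invasion tree of `o` has a.s. one end."  And (p. 1667): "For `G = ℤ^d`, Alexander [1995] proved that there is one end per tree a.s.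
under the assumption that `θ(p_c, ℤ^d) = 0`."  Here, with the tree's `limsup_n x_n = p_c` (gen 26 file IV: CCN Thm 3.2 + Barsky–Grimmett–Newman) and
`x_n > p_c` infinitely often (gen 26 file V ⇐ p205010), the deterministic files XXVIII–XXIX give, for every `d ≥ 2`, UNCONDITIONALLY:

* §1 `ae_forall_eventually_acceptedLabel_le` — a.s., for every real `y > p_c(ℤ^d)`, `x_n ≤ y` eventually (all levels at once).
* §2 **`ae_forall_exists_isOutlet_of_continuity`** (`θ(p_c) = 0` as hypothesis) and **`ae_forall_exists_isOutlet`** (via p205010): a.s. there are outlet steps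
  beyond every time, each with label `> p_c`; **`ae_outlets`**: a.s. the outlet set is infinite, outlet labels are `> p_c`, strictly decreasing, and for every
  `y > p_c` eventually `≤ y` — **`τ̂_k ↓ p_c(ℤ^d)` strictly**.
* §3 **`ae_forall_exists_cutEdge`** — a.s. for every `k` there is an outlet bond `ê` absorbed after time `k`, with label `> p_c`, such that in `T ∖ ê` the
  origin's side is EXACTLY the finite pond closure `I_m` and infinitely many invaded vertices are cut off: the invasion tree of `ℤ^d` has infinitely many
  cut-edges separating the origin from infinity.
* §4 **`ae_invasionTree_oneEnded`** — **a.s. any two self-avoiding rays of the invasion tree from the origin pass through common edges beyond every index**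
  (one end), and every ray crosses every outlet bond outwards (`ae_ray_crosses_every_outlet`).
* §5 THE FIRST OUTLET: a.s. the largest label ever accepted is attained, at the first outlet (`ae_exists_firstOutlet`), and
  **`labelMeasure_real_firstOutlet_label_le`: `μ{τ̂_1 ≤ y} = θ(y)`** — the law of the first outlet's label is the percolation probability (gen 26 file VII).
* §6 PONDS: at every outlet `m` and every level `y < x_m` the pond closure `I_m` is a union of COMPLETE `y`-clusters (every graph, gen 26 file IX's
  `coe_invasion_eq_biUnion_openCluster_of_lt_acceptedLabel`; `coe_invasion_eq_biUnion_openCluster_of_isOutlet` for later levels); on `ℤ^d` a.s. at every outlet this holds at some SUPERcritical level `y ∈ (p_c, x_m)`: the ponds are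
  finite unions of finite supercritical-level clusters (`ae_ponds_supercritical`).
* §7 `invasionTree_oneEnded_Z3` — the `ℤ³` summary.

References: R. Lyons, Y. Peres, O. Schramm, Ann. Probab. 34 (2006) 1665–1692, Thm. 1.1 / Thm. 3.12 and p. 1667 [LyonsPeresSchramm2006]; R. Lyons, Y. Peres,
*Probability on Trees and Networks* (2016), Thm. 11.12 [LyonsPeres2016]; K. S. Alexander, Ann. Probab. 23 (1995) 87–104; M. Damron, A. Sapozhnikov,
B. Vágvölgyi, Ann. Probab. 37 (2009) 2297–2331, §1.1; J. T. Chayes, L. Chayes, C. M. Newman, Comm. Math. Phys. 101 (1985) [ChayesChayesNewman1985].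
-/

noncomputable section

namespace Summit.CriticalPhenomena.PercolationContinuityZ3.Theorems.Rsw3

open Finset Filter MeasureTheory Topology Literature.Probability.LatticeModels Literature.Probability.Percolation
open Literature.Probability.Percolation.Invasion

variable {d : ℕ}

/-! ## §1 The label hypotheses hold almost surely on `ℤ^d` -/

/-- A.s. on `ℤ^d` (`d ≥ 2`): for EVERY real level `y > p_c(ℤ^d)` the accepted labels are eventually `≤ y` (CCN Thm 3.2 + BGN; all levels at once, real
levels `≥ 1` via `p_c < 1`). [cite: ChayesChayesNewman1985, Thm 3.2] -/
theorem ae_forall_eventually_acceptedLabel_le (hd : 2 ≤ d) :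
    ∀ᵐ U ∂(labelMeasure (Site d)), ∀ y : ℝ, criticalProb (zdGraph d) (0 : Site d) < y →
      ∀ᶠ n in atTop, acceptedLabel (zdGraph d) U 0 n ≤ y := by
  filter_upwards [ae_acceptedLabel_selfOrganised hd] with U hU
  intro y hy
  by_cases hy1 : y ≤ 1
  · have h0 : (0 : ℝ) ≤ y := ((criticalProbI d).2.1).trans hy.le
    exact hU.1 ⟨y, h0, hy1⟩ hy
  · push Not at hy1
    have h1 : criticalProb (zdGraph d) (0 : Site d) < ((1 : unitInterval) : ℝ) := by
      rw [Set.Icc.coe_one]; exact criticalProb_zd_lt_one hd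
    exact (hU.1 1 h1).mono fun n hn => hn.trans (by rw [Set.Icc.coe_one]; exact hy1.le)

/-! ## §2 Outlets exist beyond every time, almost surely -/

/-- **Structural theorem** (`d ≥ 2`): IF `θ(p_c(ℤ^d)) = 0` THEN almost surely the invasion of `ℤ^d` from the origin has outlet steps beyond every time,
each with label `> p_c` — the first paragraph of Lyons–Peres–Schramm's proof of Thm. 3.12 (their hypothesis `θ(p_c) = 0` made explicit).
[cite: LyonsPeresSchramm2006, Thm. 3.12 (proof, first paragraph)] -/
theorem ae_forall_exists_isOutlet_of_continuity (hd : 2 ≤ d) (hθ : PercolationContinuity d) :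
    ∀ᵐ U ∂(labelMeasure (Site d)), ∀ k, ∃ m, k ≤ m ∧ IsOutlet (zdGraph d) U 0 m ∧
      criticalProb (zdGraph d) (0 : Site d) < acceptedLabel (zdGraph d) U 0 m := by
  filter_upwards [ae_frequently_lt_acceptedLabel_of_theta_eq_zero (by omega) (criticalProbI d) hθ,
    ae_forall_eventually_acceptedLabel_le hd] with U hfreq hev
  exact forall_exists_isOutlet hfreq hev

/-- **OUTLETS OF THE INVASION OF `ℤ^d` EXIST BEYOND EVERY TIME, ALMOST SURELY, FOR EVERY `d ≥ 2`** — unconditionally, via p205010 (`θ(p_c(ℤ^d)) = 0`).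
[cite: LyonsPeresSchramm2006, Thm. 3.12 (proof, first paragraph)] -/
theorem ae_forall_exists_isOutlet (hd : 2 ≤ d) :
    ∀ᵐ U ∂(labelMeasure (Site d)), ∀ k, ∃ m, k ≤ m ∧ IsOutlet (zdGraph d) U 0 m ∧
      criticalProb (zdGraph d) (0 : Site d) < acceptedLabel (zdGraph d) U 0 m :=
  ae_forall_exists_isOutlet_of_continuity hd (CSH.percolationContinuity_allDimensions d hd)

/-- **THE OUTLET CHAIN OF `ℤ^d`** (`d ≥ 2`, via p205010): almost surely (i) the set of outlet steps is infinite; (ii) every outlet label is `> p_c(ℤ^d)`;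
(iii) outlet labels strictly decrease in time; (iv) for every `y > p_c` all outlets from some time on have label `≤ y`.  That is, the outlet labels
`τ̂_1 > τ̂_2 > ⋯` of Damron–Sapozhnikov–Vágvölgyi exist in every dimension and converge to `p_c(ℤ^d)` strictly from above.
[cite: LyonsPeresSchramm2006, Thm. 3.12 (proof: "the limsup of the labels along that end is equal to p_c")] -/
theorem ae_outlets (hd : 2 ≤ d) :
    ∀ᵐ U ∂(labelMeasure (Site d)),
      {m | IsOutlet (zdGraph d) U 0 m}.Infinite ∧
      (∀ m, IsOutlet (zdGraph d) U 0 m → criticalProb (zdGraph d) (0 : Site d) < acceptedLabel (zdGraph d) U 0 m) ∧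
      (∀ m m', IsOutlet (zdGraph d) U 0 m → m < m' → acceptedLabel (zdGraph d) U 0 m' < acceptedLabel (zdGraph d) U 0 m) ∧
      (∀ y : ℝ, criticalProb (zdGraph d) (0 : Site d) < y → ∀ᶠ m in atTop, IsOutlet (zdGraph d) U 0 m →
        criticalProb (zdGraph d) (0 : Site d) < acceptedLabel (zdGraph d) U 0 m ∧ acceptedLabel (zdGraph d) U 0 m ≤ y) := by
  filter_upwards [ae_frequently_criticalProb_lt_acceptedLabel hd, ae_forall_eventually_acceptedLabel_le hd] with U hfreq hev
  exact ⟨setOf_isOutlet_infinite hfreq hev, fun m hm => lt_acceptedLabel_of_isOutlet hm hfreq, fun m m' hm h => IsOutlet.acceptedLabel_lt _ hm h,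
    fun y hy => eventually_isOutlet_acceptedLabel_le hfreq hev hy⟩

/-! ## §3 Infinitely many cut-edges separate the origin from infinity -/

/-- **THE INVASION TREE OF `ℤ^d` HAS INFINITELY MANY CUT-EDGES SEPARATING THE ORIGIN FROM INFINITY** (`d ≥ 2`, via p205010): almost surely, for every `k`
there is an outlet step `m ≥ k` whose bond `ê = s(a.1, a.2)` (`a` the absorbed dart, label `U ê = x_m > p_c`) satisfies: in `T ∖ ê` the vertices joined to
the origin are EXACTLY the finite pond closure `I_m`, and infinitely many invaded vertices are NOT joined to the origin.
[cite: LyonsPeresSchramm2006, Thm. 3.12 (proof: "the edge e_k separates o from infinity in the invasion tree of o")] -/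
theorem ae_forall_exists_cutEdge (hd : 2 ≤ d) :
    ∀ᵐ U ∂(labelMeasure (Site d)), ∀ k, ∃ m, k ≤ m ∧ IsOutlet (zdGraph d) U 0 m ∧ ∃ a : Site d × Site d,
      newDart (zdGraph d) U (invasion (zdGraph d) U 0 m) = some a ∧
      criticalProb (zdGraph d) (0 : Site d) < U s(a.1, a.2) ∧
      (∀ v, ((tree (zdGraph d) U 0).deleteEdges {s(a.1, a.2)}).Reachable 0 v ↔ v ∈ invasion (zdGraph d) U 0 m) ∧
      {v | v ∈ invadedRegion (zdGraph d) U 0 ∧ ¬ ((tree (zdGraph d) U 0).deleteEdges {s(a.1, a.2)}).Reachable 0 v}.Infinite := by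
  haveI : Nonempty (Fin d) := ⟨⟨0, by omega⟩⟩
  haveI : Infinite (Site d) := Pi.infinite_of_right
  filter_upwards [ae_forall_exists_isOutlet hd] with U hU
  intro k
  obtain ⟨m, hkm, hm, hpc⟩ := hU k
  obtain ⟨a, ha⟩ := exists_newDart_eq_some (U := U) (boundaryDarts_invasion_nonempty zdGraph_preconnected_holds U 0 m)
  refine ⟨m, hkm, hm, a, ha, ?_, fun v => reachable_deleteEdges_outlet_iff hm ha,
    infinite_setOf_not_reachable_deleteEdges_outlet zdGraph_preconnected_holds hm ha⟩
  rwa [acceptedLabel_of_eq_some _ ha] at hpc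

/-! ## §4 One end -/

/-- **THE INVASION TREE OF `ℤ^d` HAS ONE END, ALMOST SURELY, IN EVERY DIMENSION `d ≥ 2`** (Lyons–Peres–Schramm 2006 Thm. 3.12 ¶1 / Alexander 1995 — there
conditional on `θ(p_c, ℤ^d) = 0`, here unconditional by p205010): almost surely, any two self-avoiding rays `r, r'` of the invasion tree starting at the
origin pass through a common oriented edge beyond every index — `r i = r' i'`, `r (i+1) = r' (i'+1)` with `i ≥ N` for every `N`.  (For `3 ≤ d ≤ 6` this was
open exactly as `θ(p_c) = 0` was.)
[cite: LyonsPeresSchramm2006, Thm. 1.1 and Thm. 3.12 (proof, first paragraph); p. 1667 (Alexander, ℤ^d under θ(p_c)=0)] -/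
theorem ae_invasionTree_oneEnded (hd : 2 ≤ d) :
    ∀ᵐ U ∂(labelMeasure (Site d)), ∀ r r' : ℕ → Site d, Function.Injective r → Function.Injective r' → r 0 = 0 → r' 0 = 0 →
      (∀ i, (tree (zdGraph d) U 0).Adj (r i) (r (i + 1))) → (∀ i, (tree (zdGraph d) U 0).Adj (r' i) (r' (i + 1))) →
      ∀ N, ∃ i i', N ≤ i ∧ r i = r' i' ∧ r (i + 1) = r' (i' + 1) := by
  haveI : Nonempty (Fin d) := ⟨⟨0, by omega⟩⟩
  haveI : Infinite (Site d) := Pi.infinite_of_right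
  filter_upwards [ae_forall_exists_isOutlet hd] with U hU
  intro r r' hr hr' h0 h0' hadj hadj' N
  exact rays_meet_beyond zdGraph_preconnected_holds (fun k => (hU k).imp fun m hm => ⟨hm.1, hm.2.1⟩) hr hr' h0 h0' hadj hadj' N

/-- **Every ray crosses every outlet, outwards** (`d ≥ 2`, a.s.): for every self-avoiding ray `r` of the invasion tree from the origin and every outlet step
`m` (absorbed dart `a`), `r` stays in `I_m` up to some index `i` with `r i = a.1` and then `r (i+1) = a.2`; such crossings occur beyond every index.
[cite: LyonsPeresSchramm2006, Thm. 3.12 (proof)] -/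
theorem ae_ray_crosses_every_outlet (hd : 2 ≤ d) :
    ∀ᵐ U ∂(labelMeasure (Site d)), ∀ r : ℕ → Site d, Function.Injective r → r 0 = 0 →
      (∀ i, (tree (zdGraph d) U 0).Adj (r i) (r (i + 1))) →
      (∀ m (a : Site d × Site d), IsOutlet (zdGraph d) U 0 m → newDart (zdGraph d) U (invasion (zdGraph d) U 0 m) = some a →
        ∃ i, (∀ j ≤ i, r j ∈ invasion (zdGraph d) U 0 m) ∧ r i = a.1 ∧ r (i + 1) = a.2) ∧
      ∀ N, ∃ m i, ∃ a : Site d × Site d, IsOutlet (zdGraph d) U 0 m ∧ N ≤ i ∧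
        newDart (zdGraph d) U (invasion (zdGraph d) U 0 m) = some a ∧ (∀ j ≤ i, r j ∈ invasion (zdGraph d) U 0 m) ∧ r i = a.1 ∧ r (i + 1) = a.2 := by
  haveI : Nonempty (Fin d) := ⟨⟨0, by omega⟩⟩
  haveI : Infinite (Site d) := Pi.infinite_of_right
  filter_upwards [ae_forall_exists_isOutlet hd] with U hU
  intro r hr h0 hadj
  exact ⟨fun m a hm ha => ray_crosses_outlet hm ha hr h0 hadj,
    exists_outlet_crossing_ge zdGraph_preconnected_holds (fun k => (hU k).imp fun m hm => ⟨hm.1, hm.2.1⟩) hr h0 hadj⟩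

/-! ## §5 The first outlet: the largest invaded label, with distribution function `θ` -/

/-- **The first outlet** (`d ≥ 2`, a.s.): the largest label ever accepted by the invasion of `ℤ^d` is attained, at an outlet step `m₁` preceded by no outlet,
and it is `> p_c(ℤ^d)` — Damron–Sapozhnikov–Vágvölgyi's `τ̂_1 = max{τ_e : e invaded} > p_c`, `ê_1` the bond attaining it, now in every dimension.
[cite: LyonsPeresSchramm2006, Thm. 3.12 (proof)] -/
theorem ae_exists_firstOutlet (hd : 2 ≤ d) :
    ∀ᵐ U ∂(labelMeasure (Site d)), ∃ m, IsOutlet (zdGraph d) U 0 m ∧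
      criticalProb (zdGraph d) (0 : Site d) < acceptedLabel (zdGraph d) U 0 m ∧
      (∀ n, acceptedLabel (zdGraph d) U 0 n ≤ acceptedLabel (zdGraph d) U 0 m) ∧ ∀ m', m' < m → ¬ IsOutlet (zdGraph d) U 0 m' := by
  filter_upwards [ae_frequently_criticalProb_lt_acceptedLabel hd, ae_forall_eventually_acceptedLabel_le hd] with U hfreq hev
  exact exists_isOutlet_forall_acceptedLabel_le hfreq hev

/-- **THE LAW OF THE FIRST OUTLET'S LABEL IS `θ`** (`d ≥ 2`): `μ{U : the largest accepted label (attained at the first outlet) is ≤ y} = θ(y)` for every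
`y ∈ [0,1]` — the event "some outlet carries the maximal label and that label is `≤ y`" has probability `θ(y)` (gen 26 file VII gives
`μ{∀ n, x_n ≤ y} = θ(y)`; a.s. the maximum is attained at an outlet).  By p205010 and Grimmett's Thm (8.8) `θ` is continuous on `[0,1]`, so `τ̂_1` has a
continuous distribution function. [cite: ChayesChayesNewman1985, Thm 3.1] -/
theorem labelMeasure_real_firstOutlet_label_le (hd : 2 ≤ d) (y : unitInterval) :
    (labelMeasure (Site d)).real {U | ∃ m, IsOutlet (zdGraph d) U 0 m ∧ (∀ n, acceptedLabel (zdGraph d) U 0 n ≤ acceptedLabel (zdGraph d) U 0 m) ∧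
      acceptedLabel (zdGraph d) U 0 m ≤ y} = theta (zdGraph d) (0 : Site d) y := by
  rw [← labelMeasure_real_forall_acceptedLabel_le (by omega) y]
  refine measureReal_congr (Filter.eventuallyEq_set.2 ?_)
  filter_upwards [ae_exists_firstOutlet hd] with U hU
  constructor
  · rintro ⟨m, -, hmax, hmy⟩ n
    exact (hmax n).trans hmy
  · intro h
    obtain ⟨m, hm, -, hmax, -⟩ := hU
    exact ⟨m, hm, hmax, h m⟩

/-! ## §6 Ponds are unions of complete clusters -/

section General

variable {V : Type*} [DecidableEq V] {G : SimpleGraph V} [G.LocallyFinite]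

/-- **At an outlet, the pond closure is a union of complete `y`-clusters for every `y < x_m`** (every graph, every label field): `I_m = ⋃_{u ∈ I_m} C_y(u)`
(CCN's cluster-absorption priority, gen 26 file IX); in particular every such `C_y(u)` is finite. [cite: ChayesChayesNewman1985, §3 (ii) (clusters are absorbed whole)] -/
theorem coe_invasion_eq_biUnion_openCluster_of_isOutlet {U : Sym2 V → ℝ} {o : V} {m n : ℕ} (hm : IsOutlet G U o m) (hn : m < n)
    {y : ℝ} (hy : y ≤ acceptedLabel G U o n) :
    (↑(invasion G U o m) : Set V) = ⋃ u ∈ invasion G U o m, openCluster (configOfLabels y U G) u :=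
  coe_invasion_eq_biUnion_openCluster_of_lt_acceptedLabel (hy.trans_lt (hm n hn))

end General

/-- **PONDS OF `ℤ^d` ARE FINITE UNIONS OF FINITE SUPERCRITICAL-LEVEL CLUSTERS** (`d ≥ 2`, a.s., via p205010): at every outlet step `m` there is a level
`y` with `p_c(ℤ^d) < y < x_m`, and for every such `y` the pond closure `I_m` is the union of the COMPLETE `y`-clusters of its vertices — all of them finite
although `y` is supercritical. [cite: ChayesChayesNewman1985, §3 (ii)] -/
theorem ae_ponds_supercritical (hd : 2 ≤ d) :
    ∀ᵐ U ∂(labelMeasure (Site d)), ∀ m, IsOutlet (zdGraph d) U 0 m →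
      criticalProb (zdGraph d) (0 : Site d) < acceptedLabel (zdGraph d) U 0 m ∧
      ∀ y : ℝ, y < acceptedLabel (zdGraph d) U 0 m →
        (↑(invasion (zdGraph d) U 0 m) : Set (Site d)) =
            ⋃ u ∈ invasion (zdGraph d) U 0 m, openCluster (configOfLabels y U (zdGraph d)) u ∧
        ∀ u ∈ invasion (zdGraph d) U 0 m, (openCluster (configOfLabels y U (zdGraph d)) u).Finite := by
  filter_upwards [ae_outlets hd] with U hU
  intro m hm
  refine ⟨hU.2.1 m hm, fun y hy => ⟨coe_invasion_eq_biUnion_openCluster_of_lt_acceptedLabel hy, fun u hu => ?_⟩⟩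
  refine (invasion (zdGraph d) U 0 m).finite_toSet.subset ?_
  rw [coe_invasion_eq_biUnion_openCluster_of_lt_acceptedLabel hy]
  exact Set.subset_biUnion_of_mem (u := fun u => openCluster (configOfLabels y U (zdGraph d)) u) hu

/-! ## §7 `ℤ³` -/

/-- **`ℤ³` SUMMARY (via p205010).**  For invasion percolation on `ℤ³` from the origin, almost surely: there are outlet steps beyond every time, with labels
`> p_c(ℤ³)`, strictly decreasing, eventually below every `y > p_c(ℤ³)`; each outlet bond is a cut-edge of the invasion tree whose origin side is the finite
pond closure; and any two self-avoiding rays of the invasion tree from the origin share edges beyond every index — **the invasion tree of `ℤ³` has one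
end**. [cite: LyonsPeresSchramm2006, Thm. 1.1 / Thm. 3.12; p. 1667] -/
theorem invasionTree_oneEnded_Z3 :
    ∀ᵐ U ∂(labelMeasure (Site 3)),
      (∀ k, ∃ m, k ≤ m ∧ IsOutlet (zdGraph 3) U 0 m ∧ criticalProb (zdGraph 3) (0 : Site 3) < acceptedLabel (zdGraph 3) U 0 m) ∧
      (∀ m m', IsOutlet (zdGraph 3) U 0 m → m < m' → acceptedLabel (zdGraph 3) U 0 m' < acceptedLabel (zdGraph 3) U 0 m) ∧
      (∀ y : ℝ, criticalProb (zdGraph 3) (0 : Site 3) < y → ∀ᶠ m in atTop, IsOutlet (zdGraph 3) U 0 m → acceptedLabel (zdGraph 3) U 0 m ≤ y) ∧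
      (∀ m (a : Site 3 × Site 3), IsOutlet (zdGraph 3) U 0 m → newDart (zdGraph 3) U (invasion (zdGraph 3) U 0 m) = some a →
        ∀ v, ((tree (zdGraph 3) U 0).deleteEdges {s(a.1, a.2)}).Reachable 0 v ↔ v ∈ invasion (zdGraph 3) U 0 m) ∧
      (∀ r r' : ℕ → Site 3, Function.Injective r → Function.Injective r' → r 0 = 0 → r' 0 = 0 →
        (∀ i, (tree (zdGraph 3) U 0).Adj (r i) (r (i + 1))) → (∀ i, (tree (zdGraph 3) U 0).Adj (r' i) (r' (i + 1))) →
        ∀ N, ∃ i i', N ≤ i ∧ r i = r' i' ∧ r (i + 1) = r' (i' + 1)) := by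
  have hd : 2 ≤ 3 := by norm_num
  filter_upwards [ae_forall_exists_isOutlet hd, ae_outlets hd, ae_invasionTree_oneEnded hd] with U h1 h2 h3
  refine ⟨h1, h2.2.2.1, fun y hy => (h2.2.2.2 y hy).mono fun m hm hout => (hm hout).2, fun m a hm ha v => reachable_deleteEdges_outlet_iff hm ha, h3⟩

end Summit.CriticalPhenomena.PercolationContinuityZ3.Theorems.Rsw3
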